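import Literature.NumberTheory.EllipticCurves.KugaSatoSchollProjector
import HarnessLib

/-!
# Scholl's projector absorbs the generators through the character `ε`

Topic: `Literature/NumberTheory/EllipticCurves`. Complement to `KugaSatoSchollProjector.lean`, which
constructs Scholl's projector `Π_ε = Π_T Π_M Π_S ∈ ℚ[Aut W]` of a `KugaSatoVariety K m N`
(Deninger–Scholl 5.3 (i)) and proves `Π_ε² = Π_ε`. Here we prove the relations which say that
`Π_ε` **cuts out the `ε`-isotypic part**: for the generators of the group `Γ`,

* `[translW i u] Π_ε = Π_ε = Π_ε [translW i u]` — the translations by `N`-torsion sections act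
  trivially ("the trivial character on `(ℤ/n)^{2k}`");
* `[negW i] Π_ε = -Π_ε = Π_ε [negW i]` — each inversion acts by `-1` ("the product character on
  `μ₂^k`");
* `[permW σ] Π_ε = sgn(σ) Π_ε = Π_ε [permW σ]` — the permutations act through the sign ("the sign
  character of `S_k`"),

(`KugaSatoVariety.of_translA_mul_schollProjector`, `…_negA_…`, `…_permA_…` and the mirror
images `schollProjector_mul_of_…`), from the general absorption rule
`[ρ h] e_χ = χ(h⁻¹) e_χ = e_χ [ρ h]` for the averaging idempotent `e_χ = |G|⁻¹ ∑ χ(g) [ρ g]`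
(`of_mul_characterProjector_eq_smul`, `characterProjector_mul_of_eq_smul`) and the commutation of
the three factors of `Π_ε` proved in `KugaSatoSchollProjector.lean`. Consequently, in any
`ℚ[Aut W]`-module (e.g. the cohomology of `W`), the image of `Π_ε` consists of vectors on which
`Γ` acts through `ε` (Deninger–Scholl 5.3 (i); Scholl 1990, §1). Same hypothesis
`[IsCommMonObj V.curve.E]` as there; no named facts.

## References

* C. Deninger, A. J. Scholl, *The Beilinson conjectures*, in *L-functions and Arithmetic*,
  LMS LNS 153 (1991), 5.3 (i). [DeningerScholl1991]
* A. J. Scholl, *Motives for modular forms*, Invent. Math. 100 (1990), §1. [Scholl1990]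
-/

universe u

open CategoryTheory Limits AlgebraicGeometry MonoidalCategory CartesianMonoidalCategory
open scoped MonObj

noncomputable section

namespace Literature.NumberTheory.EllipticCurves

/-! ### Absorption of `ρ(G)` by the averaging idempotent -/

section CharacterProjector

variable {G M : Type*} [Group G] [Fintype G] [Monoid M]

/-- **Left absorption**: `[ρ h] e_χ = χ(h⁻¹) e_χ` for `e_χ = |G|⁻¹ ∑_g χ(g) [ρ g]` (reindex
`g ↦ h g`). [folklore] -/
theorem of_mul_characterProjector_eq_smul (ρ : G →* M) (χ : G →* ℚ) (h : G) :
    MonoidAlgebra.of ℚ M (ρ h) * characterProjector ρ χ = χ h⁻¹ • characterProjector ρ χ := by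
  classical
  rw [characterProjector, mul_smul_comm, smul_comm (χ h⁻¹)]
  congr 1
  rw [Finset.mul_sum, Finset.smul_sum]
  refine Fintype.sum_bijective (h * ·) (Group.mulLeft_bijective h) _ _ fun g => ?_
  rw [mul_smul_comm, ← map_mul, ← map_mul, smul_smul, ← map_mul χ, inv_mul_cancel_left]

/-- **Right absorption**: `e_χ [ρ h] = χ(h⁻¹) e_χ` (reindex `g ↦ g h`). [folklore] -/
theorem characterProjector_mul_of_eq_smul (ρ : G →* M) (χ : G →* ℚ) (h : G) :
    characterProjector ρ χ * MonoidAlgebra.of ℚ M (ρ h) = χ h⁻¹ • characterProjector ρ χ := by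
  classical
  rw [characterProjector, smul_mul_assoc, smul_comm (χ h⁻¹)]
  congr 1
  rw [Finset.sum_mul, Finset.smul_sum]
  refine Fintype.sum_bijective (· * h) (Group.mulRight_bijective h) _ _ fun g => ?_
  rw [smul_mul_assoc, ← map_mul, ← map_mul, smul_smul, mul_comm (χ h⁻¹), ← map_mul χ,
    mul_inv_cancel_right]

/-- For the trivial character the idempotent absorbs `ρ(G)` outright: `[ρ h] e = e`. [folklore] -/
theorem of_mul_characterProjector_one (ρ : G →* M) (h : G) :
    MonoidAlgebra.of ℚ M (ρ h) * characterProjector ρ 1 = characterProjector ρ 1 := by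
  rw [of_mul_characterProjector_eq_smul, MonoidHom.one_apply, one_smul]

/-- For the trivial character: `e [ρ h] = e`. [folklore] -/
theorem characterProjector_one_mul_of (ρ : G →* M) (h : G) :
    characterProjector ρ 1 * MonoidAlgebra.of ℚ M (ρ h) = characterProjector ρ 1 := by
  rw [characterProjector_mul_of_eq_smul, MonoidHom.one_apply, one_smul]

end CharacterProjector

/-- The sign of the non-trivial element of `ℤ/2` is `-1`. [folklore] -/
theorem signZModTwo_ofAdd_one : signZModTwo (Multiplicative.ofAdd (1 : ZMod 2)) = -1 := by
  rw [signZModTwo_apply, toAdd_ofAdd, ZMod.val_one_eq_one_mod, Nat.one_mod_eq_one.mpr (by decide),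
    pow_one]

/-- The product character of the `i`-th basis element of `(ℤ/2)^m` is `-1`. [folklore] -/
theorem negPiSign_mulSingle {m : ℕ} (i : Fin m) :
    negPiSign m (Pi.mulSingle i (Multiplicative.ofAdd (1 : ZMod 2))) = -1 := by
  classical
  rw [negPiSign_apply, Finset.prod_eq_single i (fun j _ hj => by rw [Pi.mulSingle_eq_of_ne hj, map_one])
    (fun hi => absurd (Finset.mem_univ i) hi), Pi.mulSingle_eq_same, signZModTwo_ofAdd_one]

/-- `sgn` takes values in `{±1}`, so `sgn(σ⁻¹) = sgn(σ)` in `ℚ`. [folklore] -/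
theorem permSign_inv {m : ℕ} (σ : Equiv.Perm (Fin m)) : permSign m σ⁻¹ = permSign m σ := by
  rw [permSign_apply, permSign_apply, map_inv, Int.units_inv_eq_self]

namespace KugaSatoVariety

variable {K : Type u} [Field K] {m N : ℕ} (V : KugaSatoVariety K m N)

/-! ### The generators as values of the three homomorphisms -/

/-- `translW i u` is the value of `translPiHom` on the `i`-th basis vector `u`. [folklore] -/
theorem translPiHom_mulSingle [NeZero N] [IsCommMonObj V.curve.E] (i : Fin m)
    (u : ZMod N × ZMod N) :
    V.translPiHom (Pi.mulSingle i (Multiplicative.ofAdd u)) = V.translA i u := by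
  classical
  simp only [translPiHom, MonoidHom.noncommPiCoprod_mulSingle, translHom_apply, toAdd_ofAdd]

/-- `negW i` is the value of `negPiHom` on the `i`-th basis vector. [folklore] -/
theorem negPiHom_mulSingle (i : Fin m) :
    V.negPiHom (Pi.mulSingle i (Multiplicative.ofAdd (1 : ZMod 2))) = V.negA i := by
  classical
  simp only [negPiHom, MonoidHom.noncommPiCoprod_mulSingle, negHom_apply, toAdd_ofAdd,
    ZMod.val_one_eq_one_mod, Nat.one_mod_eq_one.mpr (by decide : (2 : ℕ) ≠ 1), pow_one]

/-! ### Absorption by the three factors -/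

/-- `[translW i u] Π_T = Π_T`. [folklore] -/
theorem of_translA_mul_translProjector [NeZero N] [IsCommMonObj V.curve.E] (i : Fin m)
    (u : ZMod N × ZMod N) :
    MonoidAlgebra.of ℚ _ (V.translA i u) * V.translProjector = V.translProjector := by
  rw [← V.translPiHom_mulSingle i u, translProjector, of_mul_characterProjector_one]

/-- `Π_T [translW i u] = Π_T`. [folklore] -/
theorem translProjector_mul_of_translA [NeZero N] [IsCommMonObj V.curve.E] (i : Fin m)
    (u : ZMod N × ZMod N) :
    V.translProjector * MonoidAlgebra.of ℚ _ (V.translA i u) = V.translProjector := by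
  rw [← V.translPiHom_mulSingle i u, translProjector, characterProjector_one_mul_of]

/-- `[negW i] Π_M = -Π_M`. [folklore] -/
theorem of_negA_mul_negProjector (i : Fin m) :
    MonoidAlgebra.of ℚ _ (V.negA i) * V.negProjector = -V.negProjector := by
  rw [← V.negPiHom_mulSingle i, negProjector, of_mul_characterProjector_eq_smul,
    ← Pi.mulSingle_inv, ← ofAdd_neg, ZMod.neg_eq_self_mod_two, negPiSign_mulSingle, neg_one_smul]

/-- `Π_M [negW i] = -Π_M`. [folklore] -/
theorem negProjector_mul_of_negA (i : Fin m) :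
    V.negProjector * MonoidAlgebra.of ℚ _ (V.negA i) = -V.negProjector := by
  rw [← V.negPiHom_mulSingle i, negProjector, characterProjector_mul_of_eq_smul,
    ← Pi.mulSingle_inv, ← ofAdd_neg, ZMod.neg_eq_self_mod_two, negPiSign_mulSingle, neg_one_smul]

/-- `[permW σ] Π_S = sgn(σ) Π_S`. [folklore] -/
theorem of_permA_mul_permProjector (σ : Equiv.Perm (Fin m)) :
    MonoidAlgebra.of ℚ _ (V.permA σ) * V.permProjector = permSign m σ • V.permProjector := by
  rw [← permHom_apply, permProjector, of_mul_characterProjector_eq_smul, permSign_inv]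

/-- `Π_S [permW σ] = sgn(σ) Π_S`. [folklore] -/
theorem permProjector_mul_of_permA (σ : Equiv.Perm (Fin m)) :
    V.permProjector * MonoidAlgebra.of ℚ _ (V.permA σ) = permSign m σ • V.permProjector := by
  rw [← permHom_apply, permProjector, characterProjector_mul_of_eq_smul, permSign_inv]

/-! ### Absorption by `Π_ε` -/

/-- `Π_ε = Π_S Π_M Π_T` as well (the three factors commute). [folklore] -/
theorem schollProjector_eq_mul_rev [NeZero N] [IsCommMonObj V.curve.E] :
    V.schollProjector = V.permProjector * V.negProjector * V.translProjector := by
  rw [schollProjector, V.commute_translProjector_negProjector.eq, mul_assoc,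
    V.commute_translProjector_permProjector.eq, ← mul_assoc,
    V.commute_negProjector_permProjector.eq]

/-- **The translations act trivially on `Π_ε`**: `[translW i u] Π_ε = Π_ε` ("the trivial
character on `(ℤ/n)^{2k}`", Deninger–Scholl 5.3 (i)). [cite: DeningerScholl1991, 5.3 (i)] -/
theorem of_translA_mul_schollProjector [NeZero N] [IsCommMonObj V.curve.E] (i : Fin m)
    (u : ZMod N × ZMod N) :
    MonoidAlgebra.of ℚ _ (V.translA i u) * V.schollProjector = V.schollProjector := by
  rw [schollProjector, ← mul_assoc, ← mul_assoc, of_translA_mul_translProjector]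

/-- `Π_ε [translW i u] = Π_ε`. [cite: DeningerScholl1991, 5.3 (i)] -/
theorem schollProjector_mul_of_translA [NeZero N] [IsCommMonObj V.curve.E] (i : Fin m)
    (u : ZMod N × ZMod N) :
    V.schollProjector * MonoidAlgebra.of ℚ _ (V.translA i u) = V.schollProjector := by
  rw [schollProjector_eq_mul_rev, mul_assoc, translProjector_mul_of_translA]

/-- **The inversions act by `-1` on `Π_ε`**: `[negW i] Π_ε = -Π_ε` ("the product character on
`μ₂^k`", Deninger–Scholl 5.3 (i)). [cite: DeningerScholl1991, 5.3 (i)] -/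
theorem of_negA_mul_schollProjector [NeZero N] [IsCommMonObj V.curve.E] (i : Fin m) :
    MonoidAlgebra.of ℚ _ (V.negA i) * V.schollProjector = -V.schollProjector := by
  rw [schollProjector, ← mul_assoc, ← mul_assoc, ← (V.commute_translProjector_of_negA i).eq,
    mul_assoc V.translProjector, of_negA_mul_negProjector, mul_neg, neg_mul]

/-- `Π_ε [negW i] = -Π_ε`. [cite: DeningerScholl1991, 5.3 (i)] -/
theorem schollProjector_mul_of_negA [NeZero N] [IsCommMonObj V.curve.E] (i : Fin m) :
    V.schollProjector * MonoidAlgebra.of ℚ _ (V.negA i) = -V.schollProjector := by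
  rw [schollProjector_eq_mul_rev, mul_assoc, (V.commute_translProjector_of_negA i).eq,
    ← mul_assoc, mul_assoc V.permProjector, negProjector_mul_of_negA, mul_neg, neg_mul]

/-- **The permutations act through the sign on `Π_ε`**: `[permW σ] Π_ε = sgn(σ) Π_ε` ("the sign
character of `S_k`", Deninger–Scholl 5.3 (i)). [cite: DeningerScholl1991, 5.3 (i)] -/
theorem of_permA_mul_schollProjector [NeZero N] [IsCommMonObj V.curve.E]
    (σ : Equiv.Perm (Fin m)) :
    MonoidAlgebra.of ℚ _ (V.permA σ) * V.schollProjector = permSign m σ • V.schollProjector := by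
  rw [schollProjector, ← mul_assoc, ← mul_assoc, ← (V.commute_translProjector_of_permA σ).eq,
    mul_assoc V.translProjector, ← (V.commute_negProjector_of_permA σ).eq,
    ← mul_assoc, mul_assoc (V.translProjector * V.negProjector), of_permA_mul_permProjector,
    mul_smul_comm]

/-- `Π_ε [permW σ] = sgn(σ) Π_ε`. [cite: DeningerScholl1991, 5.3 (i)] -/
theorem schollProjector_mul_of_permA [NeZero N] [IsCommMonObj V.curve.E]
    (σ : Equiv.Perm (Fin m)) :
    V.schollProjector * MonoidAlgebra.of ℚ _ (V.permA σ) = permSign m σ • V.schollProjector := by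
  rw [schollProjector, mul_assoc, permProjector_mul_of_permA, mul_smul_comm]

end KugaSatoVariety

end Literature.NumberTheory.EllipticCurves

end
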